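import Summits.BirchSwinnertonDyer.BirchSwinnertonDyer.Theorems.TwoAdicConverseGaussianStratum
import Literature.NumberTheory.EllipticCurves.BinaryQuarticStabilizerTorsion
import Mathlib.FieldTheory.IsAlgClosed.AlgebraicClosure
import HarnessLib

/-!
# Route `TwoAdicConverse` (rung S3), items 19218 / 19556: the local `2`-torsion COUNT `#E(ℚ_v)[2]` at `v = ∞`, `v = 2` and the
# MULTIPLICATIVE primes, in the currency `Nat.card (AddSubgroup.torsionBy (W.baseChange K).toAffine.Point 2)` of the tree's
# Mazur–Rubin / Kolyvagin-at-`2` files (the good odd primes are `GenusKolyTwin.natCard_twoTorsion_padic_eq`)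

Cell `bsd-2adic`, seat `bsd-2adic-conv-1` (GEN 22). THEOREMS ONLY — no named fact, no definition, nothing conditional, no `sorry`.
HONEST FRAMING: a dictionary file; it turns GEN 21/22's ROOT COUNTS of the `2`-division cubic `ψ₂²` over `ℝ`, `ℚ₂`, `ℚ_ℓ` (ℓ multiplicative)
into POINT COUNTS `#E(K)[2] = #{roots of ψ₂² in K} + 1` (tree `WeierstrassCurve.natCard_torsionBy_two_eq`, any field with `2 ≠ 0`;
roots are simple since `disc ψ₂² = 16Δ ≠ 0`), for the local conditions of the `2`-Selmer / Kolyvagin-at-`2` lines (KRR2 items 24622/24623,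
crux 23716, GenusKolyvaginAtTwo's Mazur–Rubin `T`-primes) and the pen's place data `(w_∞, w₂)` (RC-246 (B)). Nothing about `λ`, Selmer
groups or `L`-values; items stay OPEN; BSD is not proved by any of this. PARTITION (D-0054): none — RANK axis (S3); types-the-object-of.

* §1 (any field `K ⊇ ℚ`): `ψ₂²` of `W/ℚ` elliptic is SEPARABLE (`separable_twoTorsionPolynomial_rat`), the `2`-division cubic of
  `W.baseChange K` is `ψ₂².map`, and **`#E(K)[2] = (ψ₂².map K).roots.card + 1`** (`natCard_torsionBy_two_baseChange_eq`);
* §2 `v = ∞`: `#E(ℝ)[2] = 4` if `Δ > 0`, `= 2` if `Δ < 0`;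
* §3 `v = 2`: good ordinary or multiplicative ⇒ `#E(ℚ₂)[2] ∈ {2, 4}`, `= 4 ⟺ Δ ∈ ℚ₂×²`; good supersingular ⇒ `= 1`;
* §4 multiplicative `ℓ` (odd): `∈ {2, 4}`, `= 4 ⟺ Δ ∈ ℚ_ℓ×²` ⟺ (`Δ_min = ℓᵃm`, `ℓ ∤ m`) `a` even ∧ `m` QR mod `ℓ`; `Δ ∈ ℚ×²` ⇒ `= 4`
  at EVERY multiplicative prime; on (γ₂) (`−Δ ∈ ℚ×²`) `= 4 ⟺ ℓ ≡ 1 (mod 4)`.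

References: J. H. Silverman, *AEC* (2009) III.1–III.2, VII.2, C.14; B. Mazur, K. Rubin, Invent. Math. 181 (2010) Lemma 2.2;
J.-P. Serre, *A course in arithmetic* II §3.3. [SilvermanAEC2009] [MazurRubin2010] [Serre1973]
-/

set_option linter.dupNamespace false
set_option autoImplicit false

noncomputable section

open scoped Classical
open Polynomial WeierstrassCurve Literature.NumberTheory.EllipticCurves Literature.NumberTheory.EllipticCurves.Greenberg1999
  Literature.NumberTheory.EllipticCurves.Rank1Residual Summit.BirchSwinnertonDyer.Rank1Residual

namespace Summit.BirchSwinnertonDyer.BirchSwinnertonDyer.Theorems.TwoAdicTwistConverse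

variable (W : WeierstrassCurve ℚ) [W.IsElliptic] [W.IsGloballyMinimal]

/-! ## §1. `#E(K)[2] = #roots + 1` in the root-count currency -/

omit [W.IsGloballyMinimal] in
/-- **The `2`-division cubic of an elliptic curve over `ℚ` is separable** (`disc = 16Δ ≠ 0`; the three roots in `ℚ̄` are distinct).
-- adapted from `WeierstrassCurve.separable_twoTorsionPolynomial` (RealPeriod.lean, the `ℝ`-case). [cite: SilvermanAEC2009, III.1] -/
theorem separable_twoTorsionPolynomial_rat : W.twoTorsionPolynomial.toPoly.Separable := by
  have ha : W.twoTorsionPolynomial.a ≠ 0 := by norm_num [twoTorsionPolynomial]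
  have hdisc : W.twoTorsionPolynomial.discr ≠ 0 :=
    W.twoTorsionPolynomial_discr_ne_zero_of_isElliptic (isUnit_iff_ne_zero.mpr two_ne_zero)
  have hsplit : (W.twoTorsionPolynomial.toPoly.map (algebraMap ℚ (AlgebraicClosure ℚ))).Splits :=
    IsAlgClosed.splits _
  have hnodup := (Cubic.discr_ne_zero_iff_roots_nodup ha hsplit).mp hdisc
  rw [Cubic.map_roots] at hnodup
  have hne : W.twoTorsionPolynomial.toPoly.map (algebraMap ℚ (AlgebraicClosure ℚ)) ≠ 0 :=
    Polynomial.map_ne_zero (Cubic.ne_zero_of_a_ne_zero ha)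
  exact (separable_map _).mp ((nodup_roots_iff_of_splits hne hsplit).mp hnodup)

omit [W.IsElliptic] [W.IsGloballyMinimal] in
/-- The `2`-division cubic of the base change is the base change of the `2`-division cubic. [folklore] -/
theorem twoTorsionPolynomial_toPoly_baseChange {K : Type*} [Field K] [CharZero K] [Algebra ℚ K] :
    (W.baseChange K).twoTorsionPolynomial.toPoly = (W.twoTorsionPolynomial.toPoly).map (algebraMap ℚ K) := by
  rw [← Cubic.map_toPoly]
  congr 1
  simp only [Cubic.map, WeierstrassCurve.twoTorsionPolynomial, WeierstrassCurve.baseChange, WeierstrassCurve.map_b₂,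
    WeierstrassCurve.map_b₄, WeierstrassCurve.map_b₆, map_ofNat, map_mul]

omit [W.IsGloballyMinimal] in
/-- **`#E(K)[2] = #{roots of ψ₂² in K} + 1` in the root-MULTISET currency**, for any field `K ⊇ ℚ` (char `0`): the roots are simple, so the
multiset `roots` has no repetition. [cite: SilvermanAEC2009, III.2.3] [cite: MazurRubin2010, Lemma 2.2 (i)] -/
theorem natCard_torsionBy_two_baseChange_eq {K : Type*} [Field K] [CharZero K] [Algebra ℚ K] :
    Nat.card (AddSubgroup.torsionBy (W.baseChange K).toAffine.Point (2 : ℤ)) =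
      Multiset.card ((W.twoTorsionPolynomial.toPoly).map (algebraMap ℚ K)).roots + 1 := by
  rw [WeierstrassCurve.natCard_torsionBy_two_eq (W.baseChange K) two_ne_zero, twoTorsionPolynomial_toPoly_baseChange]
  congr 1
  set p := (W.twoTorsionPolynomial.toPoly).map (algebraMap ℚ K) with hp
  have hp0 : p ≠ 0 := Polynomial.map_ne_zero (Cubic.ne_zero_of_a_ne_zero (by norm_num [twoTorsionPolynomial]))
  have hnodup : p.roots.Nodup := nodup_roots ((separable_map _).mpr (separable_twoTorsionPolynomial_rat W))
  have hset : {x : K | p.IsRoot x} = (p.roots.toFinset : Set K) := by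
    ext x
    simp [Polynomial.mem_roots hp0]
  rw [hset, Set.ncard_coe_finset, Multiset.toFinset_card_of_nodup hnodup]

/-! ## §2. The real place -/

omit [W.IsGloballyMinimal] in
/-- **`#E(ℝ)[2] = 4` when `Δ > 0`** (three real roots). [cite: SilvermanAEC2009, III.1] -/
theorem natCard_torsionBy_two_real_eq_four_of_Δ_pos (hΔ : 0 < W.Δ) :
    Nat.card (AddSubgroup.torsionBy (W.baseChange ℝ).toAffine.Point (2 : ℤ)) = 4 := by
  rw [natCard_torsionBy_two_baseChange_eq, card_roots_twoTorsionPolynomial_real_eq_three_of_Δ_pos W hΔ]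

omit [W.IsGloballyMinimal] in
/-- **`#E(ℝ)[2] = 2` when `Δ < 0`** (one real root). [cite: SilvermanAEC2009, III.1] -/
theorem natCard_torsionBy_two_real_eq_two_of_Δ_neg (hΔ : W.Δ < 0) :
    Nat.card (AddSubgroup.torsionBy (W.baseChange ℝ).toAffine.Point (2 : ℤ)) = 2 := by
  rw [natCard_torsionBy_two_baseChange_eq, card_roots_twoTorsionPolynomial_real_eq_one_of_Δ_neg W hΔ]

/-! ## §3. The prime `2` -/

/-- **At a good ORDINARY or MULTIPLICATIVE `2`: `#E(ℚ₂)[2] = 4 ⟺ Δ ∈ ℚ₂×²`, and `= 2` otherwise** (GEN 21's dyadic dichotomy in point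
currency). [cite: SilvermanAEC2009, VII.2] -/
theorem natCard_torsionBy_two_padic_two_eq_of_goodOrd_or_mult (hW : GoodOrd W 2 ∨ Mult W 2) :
    Nat.card (AddSubgroup.torsionBy (W.baseChange ℚ_[2]).toAffine.Point (2 : ℤ)) =
      if IsSquare ((W.Δ : ℚ) : ℚ_[2]) then 4 else 2 := by
  rw [natCard_torsionBy_two_baseChange_eq]
  split_ifs with h
  · rw [(card_roots_twoTorsionPolynomial_padic_two_eq_three_iff_of_goodOrd_or_mult W hW).mpr h]
  · rw [card_roots_twoTorsionPolynomial_padic_two_eq_one_of_goodOrd_or_mult W hW h]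

/-- **At a good SUPERSINGULAR `2`: `#E(ℚ₂)[2] = 1`** (no `ℚ₂`-root; the height-`2` formal group has no `2`-torsion).
[cite: SilvermanAEC2009, VII.2 and IV] -/
theorem natCard_torsionBy_two_padic_two_eq_one_of_goodSS (hss : GoodSS W 2) :
    Nat.card (AddSubgroup.torsionBy (W.baseChange ℚ_[2]).toAffine.Point (2 : ℤ)) = 1 := by
  haveI : Fact (Nat.Prime 2) := ⟨Nat.prime_two⟩
  rw [natCard_torsionBy_two_baseChange_eq]
  have h0 : Multiset.card ((W.twoTorsionPolynomial.toPoly).map (algebraMap ℚ ℚ_[2])).roots = 0 := by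
    rw [Multiset.card_eq_zero, Multiset.eq_zero_iff_forall_notMem]
    intro x hx
    have hp0 : (W.twoTorsionPolynomial.toPoly).map (algebraMap ℚ ℚ_[2]) ≠ 0 :=
      Polynomial.map_ne_zero (Cubic.ne_zero_of_a_ne_zero (by norm_num [twoTorsionPolynomial]))
    rw [Polynomial.mem_roots hp0, IsRoot.def, eval_map, ← aeval_def] at hx
    apply not_exists_padic_root_twoDivisionCubic_of_goodSS_two W hss
    refine ⟨x, ?_⟩
    have : aeval x W.twoTorsionPolynomial.toPoly =
        4 * x ^ 3 + (W.b₂ : ℚ_[2]) * x ^ 2 + 2 * (W.b₄ : ℚ_[2]) * x + (W.b₆ : ℚ_[2]) := by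
      simp only [WeierstrassCurve.twoTorsionPolynomial, Cubic.toPoly, map_add, map_mul, aeval_C, aeval_X, map_pow,
        eq_ratCast]
      push_cast
      ring
    rw [← this]; exact hx
  rw [h0]

/-! ## §4. The multiplicative primes -/

/-- **At an odd MULTIPLICATIVE prime: `#E(ℚ_ℓ)[2] = 4 ⟺ Δ ∈ ℚ_ℓ×²`, `= 2` otherwise** (Tate's `2`-torsion point is always rational).
[cite: SilvermanAEC2009, C.14] -/
theorem natCard_torsionBy_two_padic_eq_of_mult_odd {ℓ : ℕ} [Fact ℓ.Prime] (hℓ : ℓ ≠ 2) (hm : Mult W ℓ) :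
    Nat.card (AddSubgroup.torsionBy (W.baseChange ℚ_[ℓ]).toAffine.Point (2 : ℤ)) =
      if IsSquare ((W.Δ : ℚ) : ℚ_[ℓ]) then 4 else 2 := by
  rw [natCard_torsionBy_two_baseChange_eq]
  split_ifs with h
  · rw [(card_roots_twoTorsionPolynomial_padic_eq_three_iff_of_mult_odd W hℓ hm).mpr h]
  · rw [card_roots_twoTorsionPolynomial_padic_eq_one_of_mult_odd_of_not_isSquare W hℓ hm h]

/-- **`#E(ℚ_ℓ)[2] ≥ 2` (indeed `∈ {2, 4}`) at every odd multiplicative prime.** [cite: SilvermanAEC2009, C.14] -/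
theorem natCard_torsionBy_two_padic_eq_two_or_four_of_mult_odd {ℓ : ℕ} [Fact ℓ.Prime] (hℓ : ℓ ≠ 2) (hm : Mult W ℓ) :
    Nat.card (AddSubgroup.torsionBy (W.baseChange ℚ_[ℓ]).toAffine.Point (2 : ℤ)) = 2 ∨
      Nat.card (AddSubgroup.torsionBy (W.baseChange ℚ_[ℓ]).toAffine.Point (2 : ℤ)) = 4 := by
  rw [natCard_torsionBy_two_padic_eq_of_mult_odd W hℓ hm]
  split_ifs
  · exact Or.inr rfl
  · exact Or.inl rfl

/-- **Desk criterion in point currency**: at an odd multiplicative `ℓ` with `Δ_min = ℓᵃ·m`, `ℓ ∤ m`: `#E(ℚ_ℓ)[2] = 4 ⟺ a` even `∧ m` QR mod `ℓ`.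
[cite: Serre1973, Ch. II §3.3 Thm 3] [cite: SilvermanAEC2009, C.14] -/
theorem natCard_torsionBy_two_padic_eq_four_iff_of_mult_odd {ℓ : ℕ} [Fact ℓ.Prime] (hℓ : ℓ ≠ 2) (hm : Mult W ℓ) {a : ℕ} {m : ℤ}
    (hΔ : minimalDiscriminantInt W = (ℓ : ℤ) ^ a * m) (hmℓ : ¬ (ℓ : ℤ) ∣ m) :
    Nat.card (AddSubgroup.torsionBy (W.baseChange ℚ_[ℓ]).toAffine.Point (2 : ℤ)) = 4 ↔ Even a ∧ IsSquare ((m : ℤ) : ZMod ℓ) := by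
  rw [← card_roots_twoTorsionPolynomial_padic_eq_three_iff_even_and_isSquare_zmod_of_mult_odd W hℓ hm hΔ hmℓ,
    natCard_torsionBy_two_baseChange_eq]
  omega

/-- **`Δ ∈ ℚ×²` ((γ₁) / full `2`-torsion) ⇒ `#E(ℚ_ℓ)[2] = 4` at EVERY multiplicative prime `ℓ`** (`ℓ = 2` included).
[cite: SilvermanAEC2009, C.14 and VII.2] -/
theorem natCard_torsionBy_two_padic_eq_four_of_mult_of_isSquare {ℓ : ℕ} [Fact ℓ.Prime] (hm : Mult W ℓ) (hΔ : IsSquare W.Δ) :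
    Nat.card (AddSubgroup.torsionBy (W.baseChange ℚ_[ℓ]).toAffine.Point (2 : ℤ)) = 4 := by
  rw [natCard_torsionBy_two_baseChange_eq, card_roots_twoTorsionPolynomial_padic_eq_three_of_mult_of_isSquare W hm hΔ]

/-- **On (γ₂) (`−Δ ∈ ℚ×²`), at an odd multiplicative `ℓ`: `#E(ℚ_ℓ)[2] = 4 ⟺ ℓ ≡ 1 (mod 4)`.** [cite: Serre1973, Ch. II §3.3 Thm 3] -/
theorem natCard_torsionBy_two_padic_eq_four_iff_mod_four_of_mult_odd_of_isSquare_neg_Δ {ℓ : ℕ} [Fact ℓ.Prime] (hℓ : ℓ ≠ 2)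
    (hm : Mult W ℓ) (h : IsSquare (-W.Δ)) :
    Nat.card (AddSubgroup.torsionBy (W.baseChange ℚ_[ℓ]).toAffine.Point (2 : ℤ)) = 4 ↔ ℓ % 4 = 1 := by
  rw [← card_roots_twoTorsionPolynomial_padic_eq_three_iff_mod_four_eq_one_of_mult_odd_of_isSquare_neg_Δ W hℓ hm h,
    natCard_torsionBy_two_baseChange_eq]
  omega


/-! ## §5 (appended, GEN 22). EVERY place at once on stratum (β) and on `Δ ∈ ℚ×²` — additive primes included

On stratum (β) the `2`-division cubic has a RATIONAL root, so the field-generic `1`/`3` dichotomy of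
`TwoAdicConverseTwoDivisionCubicMultiplicativePrimes` applies in EVERY completion with no reduction hypothesis; on `Δ ∈ ℚ×²` ((γ₁),
full `2`-torsion) one local root already forces three. (Abstract fields `K` carry their canonical `ℚ`-algebra structure `algebraRat`, as in
`TwoAdicConverseTwoDivisionCubicMultiplicativePrimes` §1.) -/

omit [W.IsGloballyMinimal] in
/-- **Stratum (β), every field `K ⊇ ℚ`: `#E(K)[2] = 4` if `Δ ∈ K×²`, `= 2` otherwise** — a rational `2`-torsion abscissa `x` is a root of `ψ₂²`
in every `K`; no reduction hypothesis (good, multiplicative, ADDITIVE primes, `2`, `∞` alike). [cite: SilvermanAEC2009, III.2.3] -/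
theorem natCard_torsionBy_two_baseChange_eq_of_hasRationalTwoTorsionX {x : ℚ} (hx : HasRationalTwoTorsionX W x)
    (K : Type*) [Field K] [CharZero K] :
    Nat.card (AddSubgroup.torsionBy (W.baseChange K).toAffine.Point (2 : ℤ)) = if IsSquare ((W.Δ : ℚ) : K) then 4 else 2 := by
  have hroot : 4 * x ^ 3 + W.b₂ * x ^ 2 + 2 * W.b₄ * x + W.b₆ = 0 := (hasRationalTwoTorsionX_iff_twoDivision W x).mp hx
  have hrootK : 4 * (algebraMap ℚ K x) ^ 3 + (W.b₂ : K) * (algebraMap ℚ K x) ^ 2 + 2 * (W.b₄ : K) * (algebraMap ℚ K x) +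
      (W.b₆ : K) = 0 := by
    have := congrArg (algebraMap ℚ K) hroot
    simp only [map_add, map_mul, map_pow, map_ofNat, map_zero, eq_ratCast] at this
    simpa using this
  rw [natCard_torsionBy_two_baseChange_eq]
  split_ifs with h
  · rw [card_roots_twoTorsionPolynomial_eq_three_of_root_of_isSquare W hrootK h]
  · rw [card_roots_twoTorsionPolynomial_eq_one_of_root_of_not_isSquare W hrootK h]

omit [W.IsGloballyMinimal] in
/-- **Stratum (β), any prime `ℓ` (good, multiplicative OR additive): `#E(ℚ_ℓ)[2] ∈ {2, 4}`, `= 4 ⟺ Δ ∈ ℚ_ℓ×²`.**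
[cite: SilvermanAEC2009, III.2.3] -/
theorem natCard_torsionBy_two_padic_eq_four_iff_of_hasRationalTwoTorsionX {x : ℚ} (hx : HasRationalTwoTorsionX W x) (ℓ : ℕ)
    [Fact ℓ.Prime] :
    Nat.card (AddSubgroup.torsionBy (W.baseChange ℚ_[ℓ]).toAffine.Point (2 : ℤ)) = 4 ↔ IsSquare ((W.Δ : ℚ) : ℚ_[ℓ]) := by
  rw [natCard_torsionBy_two_baseChange_eq_of_hasRationalTwoTorsionX W hx ℚ_[ℓ]]
  split_ifs with h
  · simp [h]
  · simp [h]

/-- **Stratum (β), desk criterion at ANY odd prime `ℓ`** (additive primes included): with `Δ_min = ℓᵃ·m`, `ℓ ∤ m`,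
`#E(ℚ_ℓ)[2] = 4 ⟺ a` even `∧ m` QR mod `ℓ` (else `= 2`). [cite: Serre1973, Ch. II §3.3 Thm 3] -/
theorem natCard_torsionBy_two_padic_eq_four_iff_even_and_isSquare_zmod_of_hasRationalTwoTorsionX {x : ℚ}
    (hx : HasRationalTwoTorsionX W x) {ℓ : ℕ} [Fact ℓ.Prime] (hℓ : ℓ ≠ 2) {a : ℕ} {m : ℤ}
    (hΔ : minimalDiscriminantInt W = (ℓ : ℤ) ^ a * m) (hmℓ : ¬ (ℓ : ℤ) ∣ m) :
    Nat.card (AddSubgroup.torsionBy (W.baseChange ℚ_[ℓ]).toAffine.Point (2 : ℤ)) = 4 ↔ Even a ∧ IsSquare ((m : ℤ) : ZMod ℓ) := by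
  rw [natCard_torsionBy_two_padic_eq_four_iff_of_hasRationalTwoTorsionX W hx ℓ, ← cast_minimalDiscriminantInt W, Rat.cast_intCast]
  constructor
  · intro h
    obtain ⟨ha, hu⟩ := GaloisImage.PadicSquareClass.even_and_isSquare_unit_of_isSquare (p := ℓ) hΔ hmℓ h
    exact ⟨Nat.even_iff.mpr ha, DeuringLadic.isSquare_zmod_of_isSquare_padic hu⟩
  · rintro ⟨⟨b, hb⟩, hsq⟩
    obtain ⟨s, hs⟩ := GaloisImage.PadicSquareClass.isSquare_intCast_padic_of_isSquare_zmod (p := ℓ) hℓ hmℓ hsq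
    refine ⟨(ℓ : ℚ_[ℓ]) ^ b * s, ?_⟩
    rw [hΔ]
    push_cast
    rw [hb, pow_add, hs]
    ring

/-- **Stratum (β) at the prime `2`, any reduction type: `#E(ℚ₂)[2] = 4 ⟺ Δ_min ≡ 1 (mod 8)` up to an even power of `2`** — in the usable
form: with `Δ_min = 2ᵃ·m`, `m` odd, `#E(ℚ₂)[2] = 4 ⟺ a` even `∧ m ≡ 1 (mod 8)`. [cite: Serre1973, Ch. II §3.3 Thm 4] -/
theorem natCard_torsionBy_two_padic_two_eq_four_iff_of_hasRationalTwoTorsionX {x : ℚ} (hx : HasRationalTwoTorsionX W x)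
    {a : ℕ} {m : ℤ} (hΔ : minimalDiscriminantInt W = (2 : ℤ) ^ a * m) (hm2 : ¬ (2 : ℤ) ∣ m) :
    Nat.card (AddSubgroup.torsionBy (W.baseChange ℚ_[2]).toAffine.Point (2 : ℤ)) = 4 ↔ Even a ∧ m % 8 = 1 := by
  haveI : Fact (Nat.Prime 2) := ⟨Nat.prime_two⟩
  rw [natCard_torsionBy_two_padic_eq_four_iff_of_hasRationalTwoTorsionX W hx 2, ← cast_minimalDiscriminantInt W, Rat.cast_intCast]
  constructor
  · intro h
    obtain ⟨ha, hu⟩ := GaloisImage.PadicSquareClass.even_and_isSquare_unit_of_isSquare (p := 2) (by exact_mod_cast hΔ) hm2 h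
    exact ⟨Nat.even_iff.mpr ha, GaloisImage.PadicSquareClass.emod_eight_eq_one_of_isSquare_padicTwo hm2 hu⟩
  · rintro ⟨⟨b, hb⟩, h8⟩
    obtain ⟨s, hs⟩ := GaloisImage.PadicSquareClass.isSquare_intCast_padicTwo_of_emod_eight h8
    refine ⟨(2 : ℚ_[2]) ^ b * s, ?_⟩
    rw [hΔ]
    push_cast
    rw [hb, pow_add, hs]
    ring

omit [W.IsGloballyMinimal] in
/-- **`Δ ∈ ℚ×²` ((γ₁) / full `2`-torsion), every field `K ⊇ ℚ`: `#E(K)[2] ∈ {1, 4}`** — one `K`-root of `ψ₂²` forces three (square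
discriminant), so `E(K)[2]` is trivial or all of `E[2]`. [cite: SilvermanAEC2009, III.2.3] -/
theorem natCard_torsionBy_two_baseChange_eq_one_or_four_of_isSquare (hΔ : IsSquare W.Δ) (K : Type*) [Field K] [CharZero K] :
    Nat.card (AddSubgroup.torsionBy (W.baseChange K).toAffine.Point (2 : ℤ)) = 1 ∨
      Nat.card (AddSubgroup.torsionBy (W.baseChange K).toAffine.Point (2 : ℤ)) = 4 := by
  rw [natCard_torsionBy_two_baseChange_eq]
  set p := (W.twoTorsionPolynomial.toPoly).map (algebraMap ℚ K) with hp
  by_cases h0 : Multiset.card p.roots = 0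
  · left; rw [h0]
  · right
    obtain ⟨r, hr⟩ := Multiset.card_pos_iff_exists_mem.mp (Nat.pos_of_ne_zero h0)
    have hp0 : p ≠ 0 := Polynomial.map_ne_zero (Cubic.ne_zero_of_a_ne_zero (by norm_num [twoTorsionPolynomial]))
    rw [Polynomial.mem_roots hp0, IsRoot.def, hp, eval_map, ← aeval_def] at hr
    have hr' : 4 * r ^ 3 + (W.b₂ : K) * r ^ 2 + 2 * (W.b₄ : K) * r + (W.b₆ : K) = 0 := by
      have : aeval r W.twoTorsionPolynomial.toPoly = 4 * r ^ 3 + (W.b₂ : K) * r ^ 2 + 2 * (W.b₄ : K) * r + (W.b₆ : K) := by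
        simp only [WeierstrassCurve.twoTorsionPolynomial, Cubic.toPoly, map_add, map_mul, aeval_C, aeval_X, map_pow, eq_ratCast]
        push_cast
        ring
      rw [← this]; exact hr
    have hΔK : IsSquare ((W.Δ : ℚ) : K) := by
      obtain ⟨v, hv⟩ := hΔ
      exact ⟨(v : K), by rw [hv]; push_cast; ring⟩
    rw [card_roots_twoTorsionPolynomial_eq_three_of_root_of_isSquare W hr' hΔK]

end Summit.BirchSwinnertonDyer.BirchSwinnertonDyer.Theorems.TwoAdicTwistConverse

end
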